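import Summits.Ventures.HSemireg.DerivedEquivalenceTransport
import Summits.Ventures.HSemireg.PerfectComplexRankDoor
import HarnessLib

/-!
# Venture HSemireg — `extRank` is transported by exact `ℂ`-linear equivalences: the (I1) sentence
# «`Extⁱ(𝓔, 𝓔) = Extⁱ(I_Z, I_Z)`» in the cell's rank currency

HONEST FRAMING. Kernel glue between seat p6's real-carrier transport (`DerivedEquivalenceTransport.lean`:
`rank_hom_shift_Q_eq`, `subsingleton_hom_shift_obj_single_of_neg'`) and seat p4's real admissibility currency
(`PerfectComplexRankDoor.lean`: `extRank X₀ E n = rank_ℂ Hom_{D(Mod 𝒪_{X₀})}(E, E⟦n⟧)` in Mathlib's derived category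
with the constructed instance `HasDerivedCategory.standard`). Nothing here is about any explicit variety, no functor is
CONSTRUCTED, and nothing here says that HC, HC_CM or HC_AV holds.

CONTENT. For a `ℂ`-linear, full and faithful functor `Φ : D(Mod 𝒪_{X₀}) ⥤ D(Mod 𝒪_{Y₀})` commuting with the shifts
(an exact `ℂ`-linear equivalence, for instance), a complex `E` on `X₀` and a complex `F` on `Y₀` with `Φ(E) ≅ F` in
`D(Mod 𝒪_{Y₀})`:
* `extRank_eq_of_iso_obj` — `extRank Y₀ F n = extRank X₀ E n` for every `n : ℤ`;
* `extRank_clauses_iff_of_iso_obj` — hence the three `Ext`-side conjuncts of `rankAdmissible`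
  («`Ext^{<0} = 0`», «`Hom = ℂ`», «`rank Ext² ≤ r`» for any bound `r`) hold for `F` iff they hold for `E`;
* `extRank_single_neg_eq_zero` — for a single `𝒪_{X₀}`-module `G` in degree `0` and `n < 0`, `extRank X₀ G[0] n = 0`
  (a sheaf has no negative self-extensions), and `extRank_neg_eq_zero_of_iso_obj_single` — so has any `F ≅ Φ(G[0])`.
This is exactly how the cell's note reads (I1) for the secant object `𝓔 = Φ(I_{p×X ∪ X×q}) ⊗ M_B` on `A₀ = X × X̂`
(`theory/TH2-ASSEMBLY-NOTE-2PAGE.md` §0): the `Ext`-ranks and the gluability of `𝓔` are those of the ideal sheaf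
`I_Z` on `X × X`, GIVEN the functor `Φ` (Orlov's `Φ_{S_X}⁻¹`, [Orlov2002DerivedAbelian] Assertion 2.8, composed with
`– ⊗ M_B`) and the model isomorphism — both inputs BY NAME / BY VALUE, as is the number `dim Ext²(I_Z, I_Z) = 18`.
WHICH CATEGORY: as in `DerivedEquivalenceTransport.lean` («WHICH CATEGORY `Φ` LIVES ON»): Orlov/Mukai print `Φ` on
`D^b(Coh)`; `extRank` lives in `D(Mod 𝒪)`; the two agree on bounded coherent complexes by [GortzWedhorn2023]
Thm. 22.42, so a consumer either supplies `Φ` on `D(Mod 𝒪)` (this file's literal hypothesis) or works on `D^b(Coh)`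
with the general-category theorems and that comparison.

References: [Orlov2002DerivedAbelian] p. 3 L33–40, Assertion 2.8; [Mukai1981] Thm. 2.2, Cor. 2.5; [Lieblich2006]
Prop. 2.1.9; [GortzWedhorn2023] Thm. 22.42.
-/

noncomputable section

open CategoryTheory CategoryTheory.Limits AlgebraicGeometry
open Literature.AlgebraicGeometry.Motives (SchemeOver)

namespace Summit.Ventures.HSemireg

variable {X₀ Y₀ : SchemeOver ℂ}

/-- **`extRank` is transported by exact `ℂ`-linear equivalences**: if `Φ(E) ≅ F` in `D(Mod 𝒪_{Y₀})` for a
`ℂ`-linear full and faithful `Φ` commuting with the shifts (Mathlib's derived categories with the constructed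
instances `HasDerivedCategory.standard`, as in `extRank`), then `extRank Y₀ F n = extRank X₀ E n` for every `n`
(«`Extⁱ(𝓔, 𝓔) = Extⁱ(I_Z, I_Z)`» for `𝓔 ≅ Φ(I_Z)`). [cite: Orlov2002DerivedAbelian, p. 3 L33–40 and Assertion 2.8]
[cite: Mukai1981, Thm. 2.2 and Cor. 2.5] -/
theorem extRank_eq_of_iso_obj (E : CochainComplex X₀.left.Modules ℤ) (F : CochainComplex Y₀.left.Modules ℤ) :
    letI := HasDerivedCategory.standard X₀.left.Modules
    letI := HasDerivedCategory.standard Y₀.left.Modules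
    ∀ (Φ : DerivedCategory X₀.left.Modules ⥤ DerivedCategory Y₀.left.Modules) [Φ.Additive] [Φ.Linear ℂ]
      [Φ.CommShift ℤ] [Φ.Full] [Φ.Faithful] (_ : Φ.obj (DerivedCategory.Q.obj E) ≅ DerivedCategory.Q.obj F)
      (n : ℤ), extRank Y₀ F n = extRank X₀ E n := by
  intro Φ _ _ _ _ _ e n
  letI := HasDerivedCategory.standard X₀.left.Modules
  letI := HasDerivedCategory.standard Y₀.left.Modules
  unfold extRank
  rw [← rank_hom_shift_Q_eq Φ E n]
  exact (Linear.homCongr ℂ e ((shiftFunctor (DerivedCategory Y₀.left.Modules) n).mapIso e)).symm.rank_eq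

/-- Hence the three `Ext`-side conjuncts of the cell's rank-admissibility clause — `Ext^{<0} = 0`, `Hom = ℂ`
(rank `1`) and `rank Ext² ≤ r` for any bound `r` — hold for `F ≅ Φ(E)` iff they hold for `E`.
[cite: Orlov2002DerivedAbelian, p. 3 L33–40] -/
theorem extRank_clauses_iff_of_iso_obj (E : CochainComplex X₀.left.Modules ℤ)
    (F : CochainComplex Y₀.left.Modules ℤ) (r : Cardinal) :
    letI := HasDerivedCategory.standard X₀.left.Modules
    letI := HasDerivedCategory.standard Y₀.left.Modules
    ∀ (Φ : DerivedCategory X₀.left.Modules ⥤ DerivedCategory Y₀.left.Modules) [Φ.Additive] [Φ.Linear ℂ]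
      [Φ.CommShift ℤ] [Φ.Full] [Φ.Faithful] (_ : Φ.obj (DerivedCategory.Q.obj E) ≅ DerivedCategory.Q.obj F),
      ((∀ k : ℤ, k < 0 → extRank Y₀ F k = 0) ∧ extRank Y₀ F 0 = 1 ∧ extRank Y₀ F 2 ≤ r) ↔
        ((∀ k : ℤ, k < 0 → extRank X₀ E k = 0) ∧ extRank X₀ E 0 = 1 ∧ extRank X₀ E 2 ≤ r) := by
  intro Φ _ _ _ _ _ e
  letI := HasDerivedCategory.standard X₀.left.Modules
  letI := HasDerivedCategory.standard Y₀.left.Modules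
  simp only [extRank_eq_of_iso_obj E F Φ e]

/-- **A sheaf has no negative self-extensions**, in the rank currency: for an `𝒪_{X₀}`-module `G` regarded as a
complex in degree `0` and `n < 0`, `extRank X₀ G[0] n = 0`. [cite: Lieblich2006, Prop. 2.1.9]
[cite: Mukai1981, p. 156 L25–27] -/
theorem extRank_single_neg_eq_zero (G : X₀.left.Modules) {n : ℤ} (hn : n < 0) :
    extRank X₀ ((CochainComplex.singleFunctor X₀.left.Modules 0).obj G) n = 0 := by
  letI := HasDerivedCategory.standard X₀.left.Modules
  unfold extRank
  haveI := DerivedCategory.subsingleton_hom_single_shift_of_neg (A := X₀.left.Modules) G hn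
  exact rank_subsingleton' ℂ _

/-- **The image of a sheaf under an exact equivalence has `Ext^{<0} = 0`**, in the rank currency: if
`F ≅ Φ(G[0])` for an `𝒪_{X₀}`-module `G`, then `extRank Y₀ F n = 0` for every `n < 0` — the gluability conjunct of
the admissibility clause for the cell's `𝓔 ≅ Φ(I_Z) ⊗ M_B`. [cite: Lieblich2006, Prop. 2.1.9]
[cite: Orlov2002DerivedAbelian, Assertion 2.8] -/
theorem extRank_neg_eq_zero_of_iso_obj_single (G : X₀.left.Modules) (F : CochainComplex Y₀.left.Modules ℤ) :
    letI := HasDerivedCategory.standard X₀.left.Modules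
    letI := HasDerivedCategory.standard Y₀.left.Modules
    ∀ (Φ : DerivedCategory X₀.left.Modules ⥤ DerivedCategory Y₀.left.Modules) [Φ.Additive] [Φ.Linear ℂ]
      [Φ.CommShift ℤ] [Φ.Full] [Φ.Faithful]
      (_ : Φ.obj (DerivedCategory.Q.obj ((CochainComplex.singleFunctor X₀.left.Modules 0).obj G)) ≅
        DerivedCategory.Q.obj F) {n : ℤ}, n < 0 → extRank Y₀ F n = 0 := by
  intro Φ _ _ _ _ _ e n hn
  letI := HasDerivedCategory.standard X₀.left.Modules
  letI := HasDerivedCategory.standard Y₀.left.Modules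
  rw [extRank_eq_of_iso_obj _ F Φ e n]
  exact extRank_single_neg_eq_zero G hn

end Summit.Ventures.HSemireg

end
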